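import Mathlib
import Literature.NumberTheory.Automorphic.TwistedQuotientConeDescentStep
import Summits.Langlands.Langlands.Theorems.IrreducibilityBySelfDualityHeckeEigenvalueFieldStubGrowthStep
import HarnessLib

/-!
# The descent theorem with polynomial growth carried along — crux HeckeEigenvalueField
# (stmt-Langlands-13632), line Sketch, stub `stub_descent_growth`

Setting of `Literature.NumberTheory.Automorphic.TwistedQuotientConeDescent{,Rows,Step}` (a linear
action `a` of `Γ` on `W` preserving an open `X`, a `Γ`-partition of unity `ψ` on `X`, the descent
step `λ' = κ - T_ψ(λ, κ)` of `TwistedQuotient.descent_step` and the descent theorem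
`TwistedQuotient.descent`).  **Statement.**  The descent theorem re-run with one more conjunct: if the
tower `κ_j` (`j ≤ p`) and the top cocycle `λ` have polynomial `C¹` bounds on `F' ⊆ X` (in a size
function `sz ≥ 1`) at all tuples from the finite set `Δ` of group elements whose `ψ`-translates are
alive near `F'`, then so does the output `β ∈ C^0`.  **Proof.**  The induction of
`TwistedQuotient.descent` on `p` (generalising over `λ`), the induction hypothesis enriched by the
growth conjunct: at each step `descent_step` supplies smoothness, equivariance, `δλ' = 0`, `dλ' = dκ`
on `X`, and the landed `stub_growth_step` supplies the growth of `λ' = κ_j - T_ψ(λ, κ_j)` from that of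
`λ` and `κ_j`.

## References

* R. Bott, L. W. Tu, *Differential Forms in Algebraic Topology*, GTM 82 (1982), §II.9.
  [BottTu1982Forms]
* A. Borel, *Regularization theorems in Lie algebra cohomology. Applications*, Duke Math. J. 50
  (1983), §3. [Borel1983Regularization]
-/

set_option linter.dupNamespace false -- the mandated namespace `Summit.Langlands.Langlands`

noncomputable section

open Set Filter Topology Literature.NumberTheory.Automorphic
  Literature.NumberTheory.Automorphic.TwistedQuotient
open scoped ContDiff Topology

namespace Summit.Langlands.Langlands.Theorems.HeckeEigenvalueField.Res

namespace DescentGrowth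

/-- **The descent theorem with growth, in `∀ p` form** (the shape of `TwistedQuotient.descent`, one
conjunct added): along a tower `κ_j ∈ C^j`, smooth and equivariant on `X`, with `dκ_{j+1} = δκ_j` on
`X`, no degree-`0` parts, and polynomial `C¹` growth on `F'` at `Δ`-tuples, every `λ ∈ C^{p+1}`,
smooth and equivariant on `X` with `δλ = 0`, `dλ = δκ_p` on `X` and polynomial `C¹` growth on `F'` at
`Δ`-tuples, descends in `p + 1` steps to an invariant `β ∈ C^0` with `dβ = dκ₀` on `X` and polynomial
`C¹` growth on `F'` at `Δ`-tuples. [cite: BottTu1982Forms, §II.9] [cite: Borel1983Regularization, §3] -/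
theorem descent_growth_aux
    {Γ 𝒢 : Type} [Group Γ] [Group 𝒢] (ι : Γ →* 𝒢) (L : Subgroup 𝒢)
    {V : Type} [NormedAddCommGroup V] [NormedSpace ℂ V] [FiniteDimensional ℂ V]
    (ρ : Representation ℂ Γ V)
    {W : Type} [NormedAddCommGroup W] [NormedSpace ℝ W] [FiniteDimensional ℝ W]
    (a : Γ →* (W →L[ℝ] W)) {X : Set W} {ψ : W → ℝ} (hψ : IsPOU a X ψ)
    (hXo : IsOpen X) (hmaps : ∀ γ : Γ, MapsTo (a γ) X X)
    (sz : W → ℝ) {F' : Set W} (hF' : F' ⊆ X) (hsz : ∀ x ∈ F', 1 ≤ sz x) (Δ : Finset Γ)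
    (hΔ : ∀ γ : Γ, γ ∉ Δ → ∀ x ∈ F', (fun y => ψ (a γ⁻¹ y)) =ᶠ[𝓝 x] fun _ => 0)
    (hψb : ∃ (C : ℝ) (k : ℕ), ∀ γ ∈ Δ, ∀ x ∈ F', |ψ (a γ⁻¹ x)| ≤ C * sz x ^ k ∧
      ‖fderiv ℝ (fun y => ψ (a γ⁻¹ y)) x‖ ≤ C * sz x ^ k ∧
      ‖iteratedFDeriv ℝ 2 (fun y => ψ (a γ⁻¹ y)) x‖ ≤ C * sz x ^ k)
    (κ : (j : ℕ) → Coch Γ L W V j) :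
    ∀ p : ℕ, (∀ j ≤ p, SmoothOn L X (κ j)) → (∀ j ≤ p, IsEquivariantOn ι L ρ (a := a) X (κ j)) →
      (∀ j < p, ∀ (g : Fin (j + 2) → Γ) (c : 𝒢 ⧸ L) (r : ℕ), ∀ x ∈ X,
        cochD L (κ (j + 1)) g c r x = delta L (κ j) g c r x) →
      (∀ j ≤ p, ∀ (g : Fin (j + 2) → Γ) (c : 𝒢 ⧸ L), ∀ x ∈ X, delta L (κ j) g c 0 x = 0) →
      (∀ j ≤ p, ∀ g : Fin (j + 1) → Γ, (∀ i, g i ∈ Δ) → ∀ (c : 𝒢 ⧸ L) (r : ℕ), ∃ (C : ℝ) (k : ℕ),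
        ∀ x ∈ F', ‖κ j g c r x‖ ≤ C * sz x ^ k ∧ ‖fderiv ℝ (κ j g c r) x‖ ≤ C * sz x ^ k) →
      ∀ lam : Coch Γ L W V (p + 1), SmoothOn L X lam → IsEquivariantOn ι L ρ (a := a) X lam →
        (∀ (g : Fin (p + 3) → Γ) (c : 𝒢 ⧸ L) (r : ℕ), ∀ x ∈ X, delta L lam g c r x = 0) →
        (∀ (g : Fin (p + 2) → Γ) (c : 𝒢 ⧸ L) (r : ℕ), ∀ x ∈ X,
          cochD L lam g c r x = delta L (κ p) g c r x) →
        (∀ g : Fin (p + 2) → Γ, (∀ i, g i ∈ Δ) → ∀ (c : 𝒢 ⧸ L) (r : ℕ), ∃ (C : ℝ) (k : ℕ),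
          ∀ x ∈ F', ‖lam g c r x‖ ≤ C * sz x ^ k ∧ ‖fderiv ℝ (lam g c r) x‖ ≤ C * sz x ^ k) →
        ∃ β : Coch Γ L W V 0, SmoothOn L X β ∧ IsEquivariantOn ι L ρ (a := a) X β ∧
          (∀ (g : Fin 2 → Γ) (c : 𝒢 ⧸ L) (r : ℕ), ∀ x ∈ X, delta L β g c r x = 0) ∧
          (∀ (g : Fin 1 → Γ) (c : 𝒢 ⧸ L) (r : ℕ), ∀ x ∈ X,
            cochD L β g c r x = cochD L (κ 0) g c r x) ∧
          ∀ g : Fin 1 → Γ, (∀ i, g i ∈ Δ) → ∀ (c : 𝒢 ⧸ L) (r : ℕ), ∃ (C : ℝ) (k : ℕ),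
            ∀ x ∈ F', ‖β g c r x‖ ≤ C * sz x ^ k ∧ ‖fderiv ℝ (β g c r) x‖ ≤ C * sz x ^ k := by
  intro p
  induction p with
  | zero =>
    intro hS hE _ h0 hb lam hlamS hlamE hδ hd hlamb
    obtain ⟨h1, h2, h3, h4⟩ := descent_step ι L ρ a hψ hXo hmaps hlamS (hS 0 le_rfl) hlamE
      (hE 0 le_rfl) hδ hd (h0 0 le_rfl)
    exact ⟨_, h1, h2, h3, h4, stub_growth_step L a hψ hXo hmaps sz hF' hsz Δ hΔ hψb lam (κ 0) hlamS
      (hS 0 le_rfl) hd (h0 0 le_rfl) hlamb (hb 0 le_rfl)⟩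
  | succ p ih =>
    intro hS hE htower h0 hb lam hlamS hlamE hδ hd hlamb
    -- the descent step `λ' = κ_{p+1} - T_ψ(λ, κ_{p+1})`: its four structural properties ...
    obtain ⟨h1, h2, h3, h4⟩ := descent_step ι L ρ a hψ hXo hmaps hlamS (hS (p + 1) le_rfl) hlamE
      (hE (p + 1) le_rfl) hδ hd (h0 (p + 1) le_rfl)
    -- ... and its polynomial `C¹` growth on `F'` at `Δ`-tuples
    have h5 := stub_growth_step L a hψ hXo hmaps sz hF' hsz Δ hΔ hψb lam (κ (p + 1)) hlamS
      (hS (p + 1) le_rfl) hd (h0 (p + 1) le_rfl) hlamb (hb (p + 1) le_rfl)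
    refine ih (fun j hj => hS j (Nat.le_succ_of_le hj)) (fun j hj => hE j (Nat.le_succ_of_le hj))
      (fun j hj => htower j (Nat.lt_succ_of_lt hj)) (fun j hj => h0 j (Nat.le_succ_of_le hj))
      (fun j hj => hb j (Nat.le_succ_of_le hj)) _ h1 h2 h3 ?_ h5
    intro g c r x hx
    rw [h4 g c r x hx]
    exact htower p (Nat.lt_succ_self p) g c r x hx

end DescentGrowth

/-- **Stub DESCENT-GROWTH — the descent theorem with polynomial growth carried along.**  The tree's
`TwistedQuotient.descent` (`p + 1` descent steps `λ' = κ - T_ψ(λ, κ)`) re-run with the extra conjunct that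
the output `β` has polynomial `C¹` bounds on `F' ⊆ X` at tuples from `Δ` (landed GROWTH-STEP
`stub_growth_step` at every step; the hypotheses on `ψ`, `sz`, `F'`, `Δ` are exactly its).  The action `a`
is passed positionally to `IsEquivariantOn` (`@`-form), the registered headers admitting no `:=`.
[cite: BottTu1982Forms, §II.9] [cite: Borel1983Regularization, §3] -/
theorem stub_descent_growth
    {Γ 𝒢 : Type} [Group Γ] [Group 𝒢] (ι : Γ →* 𝒢) (L : Subgroup 𝒢)
    {V : Type} [NormedAddCommGroup V] [NormedSpace ℂ V] [FiniteDimensional ℂ V]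
    (ρ : Representation ℂ Γ V)
    {W : Type} [NormedAddCommGroup W] [NormedSpace ℝ W] [FiniteDimensional ℝ W]
    (a : Γ →* (W →L[ℝ] W)) {X : Set W} {ψ : W → ℝ} (hψ : TwistedQuotient.IsPOU a X ψ)
    (hXo : IsOpen X) (hmaps : ∀ γ : Γ, Set.MapsTo (a γ) X X)
    (sz : W → ℝ) {F' : Set W} (hF' : F' ⊆ X) (hsz : ∀ x ∈ F', 1 ≤ sz x) (Δ : Finset Γ)
    (hΔ : ∀ γ : Γ, γ ∉ Δ → ∀ x ∈ F', (fun y => ψ (a γ⁻¹ y)) =ᶠ[𝓝 x] fun _ => 0)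
    (hψb : ∃ (C : ℝ) (k : ℕ), ∀ γ ∈ Δ, ∀ x ∈ F', |ψ (a γ⁻¹ x)| ≤ C * sz x ^ k ∧
      ‖fderiv ℝ (fun y => ψ (a γ⁻¹ y)) x‖ ≤ C * sz x ^ k ∧
      ‖iteratedFDeriv ℝ 2 (fun y => ψ (a γ⁻¹ y)) x‖ ≤ C * sz x ^ k)
    (κ : (j : ℕ) → TwistedQuotient.Coch Γ L W V j) (p : ℕ)
    (hκS : ∀ j ≤ p, TwistedQuotient.SmoothOn L X (κ j))
    (hκE : ∀ j ≤ p, @TwistedQuotient.IsEquivariantOn Γ 𝒢 _ _ ι L V _ _ ρ W _ _ a _ X j (κ j))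
    (htower : ∀ j < p, ∀ (g : Fin (j + 2) → Γ) (c : 𝒢 ⧸ L) (r : ℕ), ∀ x ∈ X,
      TwistedQuotient.cochD L (κ (j + 1)) g c r x = TwistedQuotient.delta L (κ j) g c r x)
    (hκ0 : ∀ j ≤ p, ∀ (g : Fin (j + 2) → Γ) (c : 𝒢 ⧸ L), ∀ x ∈ X, TwistedQuotient.delta L (κ j) g c 0 x = 0)
    (hκb : ∀ j ≤ p, ∀ g : Fin (j + 1) → Γ, (∀ i, g i ∈ Δ) → ∀ (c : 𝒢 ⧸ L) (r : ℕ), ∃ (C : ℝ) (k : ℕ),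
      ∀ x ∈ F', ‖κ j g c r x‖ ≤ C * sz x ^ k ∧ ‖fderiv ℝ (κ j g c r) x‖ ≤ C * sz x ^ k)
    (lam : TwistedQuotient.Coch Γ L W V (p + 1)) (hlamS : TwistedQuotient.SmoothOn L X lam)
    (hlamE : @TwistedQuotient.IsEquivariantOn Γ 𝒢 _ _ ι L V _ _ ρ W _ _ a _ X (p + 1) lam)
    (hlamδ : ∀ (g : Fin (p + 3) → Γ) (c : 𝒢 ⧸ L) (r : ℕ), ∀ x ∈ X, TwistedQuotient.delta L lam g c r x = 0)
    (hlamd : ∀ (g : Fin (p + 2) → Γ) (c : 𝒢 ⧸ L) (r : ℕ), ∀ x ∈ X,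
      TwistedQuotient.cochD L lam g c r x = TwistedQuotient.delta L (κ p) g c r x)
    (hlamb : ∀ g : Fin (p + 2) → Γ, (∀ i, g i ∈ Δ) → ∀ (c : 𝒢 ⧸ L) (r : ℕ), ∃ (C : ℝ) (k : ℕ),
      ∀ x ∈ F', ‖lam g c r x‖ ≤ C * sz x ^ k ∧ ‖fderiv ℝ (lam g c r) x‖ ≤ C * sz x ^ k) :
    ∃ β : TwistedQuotient.Coch Γ L W V 0, TwistedQuotient.SmoothOn L X β ∧
      @TwistedQuotient.IsEquivariantOn Γ 𝒢 _ _ ι L V _ _ ρ W _ _ a _ X 0 β ∧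
      (∀ (g : Fin 2 → Γ) (c : 𝒢 ⧸ L) (r : ℕ), ∀ x ∈ X, TwistedQuotient.delta L β g c r x = 0) ∧
      (∀ (g : Fin 1 → Γ) (c : 𝒢 ⧸ L) (r : ℕ), ∀ x ∈ X,
        TwistedQuotient.cochD L β g c r x = TwistedQuotient.cochD L (κ 0) g c r x) ∧
      ∀ g : Fin 1 → Γ, (∀ i, g i ∈ Δ) → ∀ (c : 𝒢 ⧸ L) (r : ℕ), ∃ (C : ℝ) (k : ℕ),
        ∀ x ∈ F', ‖β g c r x‖ ≤ C * sz x ^ k ∧ ‖fderiv ℝ (β g c r) x‖ ≤ C * sz x ^ k := by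
  exact DescentGrowth.descent_growth_aux ι L ρ a hψ hXo hmaps sz hF' hsz Δ hΔ hψb κ p hκS hκE htower
    hκ0 hκb lam hlamS hlamE hlamδ hlamd hlamb

end Summit.Langlands.Langlands.Theorems.HeckeEigenvalueField.Res

end
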